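import Summits.ResolutionOfSingularities.ResolutionOfSingularities.Theorems.PurelyInseparableDim4EquimultipleHasse
import Summits.ResolutionOfSingularities.ResolutionOfSingularities.Theorems.PurelyInseparableDim4Scope
import Literature.AlgebraicGeometry.Resolution.AdditiveFormsStructure
import HarnessLib

/-!
# Purely inseparable four-folds: the Scope file's `J_q⁺(F)` (`PIDim4.singLocusIdeal`) IS the equimultiple locus
# (brick TY-3c-scope, cell `res-dim4-pi`)

[OURS · counted 0] (D-0157 DOOR 2; continues TY-3 / TY-3b; host item stmt-ResolutionOfSingularities-16155, helper).
Nothing here proves resolution of singularities in dimension ≥ 4 / characteristic `p`. The cell's SCOPE add-on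
(`PurelyInseparableDim4Scope.lean`, desk WORD #20/#23, frame v4) defines its own monomial-formula Hasse derivative
`PIDim4.hasseDeriv` and the ideal `PIDim4.singLocusIdeal q F = ⟨D^{(α)} F : 0 < |α| < q⟩`, and phrases the ISOLATED regime
(`IsIsolated`, `NoIsolatedTrap`) and the coordinate scope through it. This file identifies those definitions with the
tree's objects, so that TY-3/TY-3b apply to them verbatim:

* `hasseDeriv_eq` — `PIDim4.hasseDeriv α F = Resolution.hasseDeriv K α F` (the monomial formula
  `x^d ↦ (∏ C(dᵢ, αᵢ)) x^{d−α}` against the Taylor-morphism definition; tree `AdditiveFormsStructure.coeff_hasseDeriv`);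
* `singLocusIdeal_eq_span` — `J_q⁺(F)` is the span of the tree's `D^{(α)} F`, `0 < |α| < q`;
* **`isEquimultiplePoint_iff_mem_zeroLocus_singLocusIdeal`** — `IsEquimultiplePoint q S j b s ↔ b ∈ V(J_q⁺(G))(K)`,
  `G = chartTransform q S j s.F`; `singLocusIdeal_le_vanishingIdeal_iff` (ideal form `J_q⁺(G) ≤ 𝔪_b`);
* `originIdeal_eq_vanishingIdeal` (`PIDim4.originIdeal K = 𝔪_0`) and **`singLocusIdeal_le_originIdeal_iff`** — the
  first clause of `IsIsolated q G` («the origin is `q`-fold») is `IsEquimultiplePoint q S j 0 s` (the SPINE point);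
* `le_idealOrder_hypSheaf_iff_of_isClosed'` — `K = K̄`: closed order-`p` points of `V(z^p + G)` =
  `{(a, b) : a^p + G(b) = 0, b ∈ V(J_p⁺(G))}` with the Scope file's `J_p⁺`.

AI-produced formalisation, weaker than expert review. bears_on: LADDER-RESOLUTION:D157-DOOR2 (res-dim4-pi · TY-3).
-/

set_option linter.dupNamespace false -- D-0017: single-problem summit path `Summit.<S>.<S>.…` by design

noncomputable section

open MvPolynomial Finset AlgebraicGeometry

namespace Summit.ResolutionOfSingularities.ResolutionOfSingularities.Theorems.PIDim4

open Literature.AlgebraicGeometry.Resolution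
open Literature.AlgebraicGeometry.Resolution.Hauser2010

namespace Equimultiple

variable {K : Type} [Field K]

/-- **The Scope file's Hasse derivative is the tree's**: `Σ_d (∏ᵢ C(dᵢ, αᵢ)) coeff_d(F) x^{d−α} = D^{(α)} F`
(coefficient of `x^β`: only `d = α + β` contributes, a term with some `dᵢ < αᵢ` having a vanishing binomial).
[cite: EGAIV4, Thm. 16.11.2 (16.11.2.1)] -/
theorem hasseDeriv_eq (α : Fin 4 →₀ ℕ) (F : MvPolynomial (Fin 4) K) :
    PIDim4.hasseDeriv α F = Literature.AlgebraicGeometry.Resolution.hasseDeriv K α F := by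
  classical
  ext β
  rw [coeff_hasseDeriv]
  simp only [PIDim4.hasseDeriv, coeff_sum, coeff_monomial]
  rw [Finset.sum_eq_single (α + β)]
  · rw [if_pos (add_tsub_cancel_left α β), Nat.cast_prod]
    congr 1
    refine (Finset.prod_subset (Finset.subset_univ α.support) fun i _ hi => ?_).symm
    rw [Finsupp.notMem_support_iff.mp hi, Nat.choose_zero_right, Nat.cast_one]
  · intro d _ hne
    split_ifs with h
    · have hnle : ¬ α ≤ d := fun hle => hne (by rw [← h, add_tsub_cancel_of_le hle])
      obtain ⟨i, hi⟩ : ∃ i, d i < α i := by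
        by_contra hall
        push Not at hall
        exact hnle (Finsupp.le_def.mpr hall)
      rw [Finset.prod_eq_zero (Finset.mem_univ i) (by rw [Nat.choose_eq_zero_of_lt hi, Nat.cast_zero]),
        zero_mul]
    · rfl
  · intro h
    rw [if_pos (add_tsub_cancel_left α β), MvPolynomial.notMem_support_iff.mp h, mul_zero]

/-- `J_q⁺(F)` is the span of the tree's Hasse derivatives `D^{(α)} F`, `0 < |α| < q`. [folklore] -/
theorem singLocusIdeal_eq_span (q : ℕ) (F : MvPolynomial (Fin 4) K) :
    singLocusIdeal q F = Ideal.span {H | ∃ α : Fin 4 →₀ ℕ, 0 < α.degree ∧ α.degree < q ∧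
      H = Literature.AlgebraicGeometry.Resolution.hasseDeriv K α F} := by
  simp only [singLocusIdeal, hasseDeriv_eq]

/-- **`IsEquimultiplePoint q S j b s ↔ b ∈ V(J_q⁺(G))(K)`** for the Scope file's `J_q⁺ = singLocusIdeal`,
`G = chartTransform q S j s.F`. [cite: Hauser2010, §F (equiconstant points)] -/
theorem isEquimultiplePoint_iff_mem_zeroLocus_singLocusIdeal (q : ℕ) (S : Finset (Fin 4)) (j : Fin 4)
    (b : Fin 4 → K) (s : State K) :
    CentreBlowup.IsEquimultiplePoint q S j b s ↔
      b ∈ MvPolynomial.zeroLocus K (singLocusIdeal q (CentreBlowup.chartTransform q S j s.F)) := by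
  rw [singLocusIdeal_eq_span, isEquimultiplePoint_iff_mem_zeroLocus]

/-- Ideal form: `J_q⁺(G) ≤ 𝔪_b ↔ IsEquimultiplePoint`. [folklore] -/
theorem singLocusIdeal_le_vanishingIdeal_iff (q : ℕ) (S : Finset (Fin 4)) (j : Fin 4) (b : Fin 4 → K)
    (s : State K) :
    singLocusIdeal q (CentreBlowup.chartTransform q S j s.F) ≤ MvPolynomial.vanishingIdeal K {b} ↔
      CentreBlowup.IsEquimultiplePoint q S j b s := by
  rw [isEquimultiplePoint_iff_mem_zeroLocus_singLocusIdeal, ← MvPolynomial.le_zeroLocus_iff_le_vanishingIdeal,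
    Set.singleton_subset_iff]

/-- The Scope file's `originIdeal K = ker (eval 0)` is the maximal ideal `𝔪_0` of the origin. [folklore] -/
theorem originIdeal_eq_vanishingIdeal :
    PIDim4.originIdeal K = MvPolynomial.vanishingIdeal K {(0 : Fin 4 → K)} := by
  ext F
  rw [PIDim4.originIdeal, RingHom.mem_ker, MvPolynomial.mem_vanishingIdeal_singleton_iff]
  exact Iff.rfl

/-- **The origin of the chart is `q`-fold (`J_q⁺(G) ≤ 𝔪_0`, first clause of `IsIsolated q G`) iff the SPINE point
`b = 0` is an equimultiple point.** [cite: Hauser2010, §F (equiconstant points)] -/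
theorem singLocusIdeal_le_originIdeal_iff (q : ℕ) (S : Finset (Fin 4)) (j : Fin 4) (s : State K) :
    singLocusIdeal q (CentreBlowup.chartTransform q S j s.F) ≤ PIDim4.originIdeal K ↔
      CentreBlowup.IsEquimultiplePoint q S j (0 : Fin 4 → K) s := by
  rw [originIdeal_eq_vanishingIdeal, singLocusIdeal_le_vanishingIdeal_iff]

/-- `K = K̄`: the closed order-`p` points of `V(z^p + G) ⊂ 𝔸⁵_K` are the `(a, b)` with `a^p + G(b) = 0` and
`b ∈ V(J_p⁺(G))`, `J_p⁺` the Scope file's `singLocusIdeal`. [cite: Hauser2010, §F (equiconstant points)] -/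
theorem le_idealOrder_hypSheaf_iff_of_isClosed' {p : ℕ} [Fact p.Prime] [CharP K p] [IsAlgClosed K]
    (S : Finset (Fin 4)) (j : Fin 4) (s : State K) {x : AffinePointBlowup.P 4 K}
    (hx : IsClosed ({x} : Set (AffinePointBlowup.P 4 K))) :
    (p : ℕ∞) ≤ idealOrder (hypSheaf p (CentreBlowup.chartTransform p S j s.F)) x ↔
      ∃ (a : K) (b : Fin 4 → K),
        x.asIdeal = MvPolynomial.vanishingIdeal K {(Fin.cons a b : Fin (4 + 1) → K)} ∧
          a ^ p + eval b (CentreBlowup.chartTransform p S j s.F) = 0 ∧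
            b ∈ MvPolynomial.zeroLocus K (singLocusIdeal p (CentreBlowup.chartTransform p S j s.F)) := by
  rw [le_idealOrder_hypSheaf_iff_of_isClosed S j s hx]
  simp only [isEquimultiplePoint_iff_mem_zeroLocus_singLocusIdeal]

end Equimultiple

end Summit.ResolutionOfSingularities.ResolutionOfSingularities.Theorems.PIDim4

end
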